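import Summits.QuantumFields.YangMills.Theorems.AlphaInputsT3ACv3AbelianEML
import Literature.MathematicalPhysics.QuantumFieldTheory.Balaban1983to89.BlockAveragingEMLProp2
import HarnessLib

/-!
# `AlphaInputsT3ACv3AbelianCurl` — STRATEGY B for 2′, toward (D6R-CHARGED): THE (0.4) LINEAR AVERAGE OF A ONE-FORM IS «TRANSPORTED-SEGMENT MEAN + A COBOUNDARY», SO ITS CURL AT A
# COARSE PLAQUETTE IS THE MEAN OVER OFFSETS OF THE FLUXES AROUND THE TRANSPORTED `L`-SQUARES — lane `pub-balaban3d`, seat alpha-2 (g3)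

WHAT (HOME `D6L-STATUS-alpha2-g3.md` §5 (b); over `…AbelianEML`: `linAvg04 a c = |I|⁻¹ Σ_i loopSum a c i + axialSum a c`).  §1 the algebra of walk sums (`wsum_append`,
`wsum_wordRev`); §2 the loop sum decomposes as `stair(σ) + segment − stair(σ′) − axial` (`loopSum_eq`); §3 averaging: the two staircase means coincide (swap `σ ↔ σ′`), so
★ `linAvg04_eq`: `ā(c) = segMean a c + Φ(c₋) − Φ(c₊)` with `Φ` a function of the coarse SITE; §4 ★★ `curl_linAvg04`: at a coarse plaquette the coboundary drops and
`curl ā = mean_r squareSum`, the flux of `a` around the `L`-square based at the offset point `emb y + n_r`.  (The bound `|squareSum| ≤ L²·max|curl a|` and its iteration to r3 are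
the successor's.)
HONEST FRAMING.  Kernel algebra; nothing of [B10]∕[7]∕[4]'s estimates asserted; count-neutral helper toward R3 2′ (`stub_laneRecordsV3`, items 19935∕19936); nothing about d = 4, the
continuum, or a mass gap.

References: T. Bałaban, Commun. Math. Phys. 109 (1987) 249–301 [Balaban1987RG1] ((0.3)–(0.4) pp.252–253); CMP 98 (1985) 17–51 [Balaban1985Averaging] ((14) p.19).
-/

set_option autoImplicit false

noncomputable section

namespace Summit.QuantumFields.YangMills.Theorems.AbelianEML

open Literature.MathematicalPhysics.QuantumFieldTheory.Balaban1983to89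
open Literature.MathematicalPhysics.QuantumFieldTheory.Balaban1983to89.T4Continuum
open Literature.MathematicalPhysics.QuantumFieldTheory.Balaban1983to89.BlockAveraging (off Idx)
open Literature.MathematicalPhysics.QuantumFieldTheory.Balaban1983to89.BlockAveragingEMLProp2 (walkEnd_replicate_true emb_shift_eq_shiftN walkEnd_stairWord_replicate
  walkEnd_stairWord_eq shift_shift_comm)
open Literature.MathematicalPhysics.QuantumFieldTheory.Balaban1983to89.B10Eq47AxialChi (shiftN)

variable {P : Params} {j : ℕ}

/-! ## §1 Algebra of walk sums -/

/-- **Walk sums are additive under concatenation** (the second word read from the end of the first walk). [folklore] -/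
theorem wsum_append (a : PBond P j → ℝ) : ∀ (x : Site P j) (w₁ w₂ : List (Letter P.d)),
    wsum a x (w₁ ++ w₂) = wsum a x w₁ + wsum a (walkEnd x w₁) w₂
  | x, [], w₂ => by simp [walkEnd]
  | x, (μ, true) :: w₁, w₂ => by
    rw [List.cons_append, wsum_cons_true, wsum_cons_true, wsum_append a (x.shift μ) w₁ w₂]
    simp only [walkEnd]; ring
  | x, (μ, false) :: w₁, w₂ => by
    rw [List.cons_append, wsum_cons_false, wsum_cons_false, wsum_append a (x.unshift μ) w₁ w₂]
    simp only [walkEnd]; ring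

/-- The reversed word read from the end of the walk retraces it: its sum is the negative. [folklore] -/
theorem wsum_wordRev (a : PBond P j → ℝ) : ∀ (x : Site P j) (w : List (Letter P.d)),
    wsum a (walkEnd x w) (wordRev w) = -wsum a x w
  | x, [] => by simp [walkEnd, wordRev]
  | x, (μ, true) :: w => by
    have hrev : wordRev ((μ, true) :: w) = wordRev w ++ [(μ, false)] := by simp [wordRev, Letter.flip]
    rw [hrev, wsum_append, wsum_cons_true]
    simp only [walkEnd]
    rw [wsum_wordRev a (x.shift μ) w]
    rw [walkEnd_walkEnd_wordRev, wsum_cons_false, wsum_nil, Site.unshift_shift]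
    ring
  | x, (μ, false) :: w => by
    have hrev : wordRev ((μ, false) :: w) = wordRev w ++ [(μ, true)] := by simp [wordRev, Letter.flip]
    rw [hrev, wsum_append, wsum_cons_false]
    simp only [walkEnd]
    rw [wsum_wordRev a (x.unshift μ) w]
    rw [walkEnd_walkEnd_wordRev, wsum_cons_true, wsum_nil]
    ring

/-! ## §2 The loop sum: staircase + segment − staircase − axial -/

/-- **THE OFFSET POINT `x = emb y + n`** (the end of every staircase `Γ^σ(n)` from `emb y`; `walkEnd_stairWord_eq`). [cite: Balaban1987RG1, (0.3) p.252] -/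
def offPt (y : Site P (j + 1)) (n : Fin P.d → ℤ) : Site P j := walkEnd (emb y) (stairWord (Equiv.refl _) n)

/-- Every staircase from `emb y` with offset `n` ends at `offPt y n`. [cite: Balaban1987RG1, (0.3) p.252] -/
theorem walkEnd_stairWord_offPt (y : Site P (j + 1)) (σ : Equiv.Perm (Fin P.d)) (n : Fin P.d → ℤ) : walkEnd (emb y) (stairWord σ n) = offPt y n :=
  walkEnd_stairWord_eq _ σ _ n

/-- **THE STAIRCASE SUM** from the block centre `emb y` along `Γ^σ(n)`. [cite: Balaban1987RG1, (0.3) p.252] -/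
def stairSum (a : PBond P j → ℝ) (y : Site P (j + 1)) (n : Fin P.d → ℤ) (σ : Equiv.Perm (Fin P.d)) : ℝ :=
  wsum a (emb y) (stairWord σ n)

/-- **THE TRANSPORTED-SEGMENT SUM**: `a` summed along the straight `L` steps `+e_μ` from the offset point `emb y + n`. [cite: Balaban1987RG1, (0.4) p.253] -/
def segSum (a : PBond P j → ℝ) (y : Site P (j + 1)) (n : Fin P.d → ℤ) (μ : Fin P.d) : ℝ :=
  wsum a (offPt y n) (List.replicate P.L (μ, true))

/-- `wordRev` of a straight run forward is the straight run backward. [folklore] -/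
theorem wordRev_replicate_true (m : ℕ) (μ : Fin P.d) : wordRev (List.replicate m (μ, true)) = List.replicate m ((μ, false) : Letter P.d) := by
  simp [wordRev, Letter.flip, List.map_replicate]

/-- The axial walk from `emb c₋` ends at `emb c₊`. [folklore] -/
theorem walkEnd_axial (c : PBond P (j + 1)) : walkEnd (emb c.src) (List.replicate P.L (c.dir, true)) = emb c.tgt := by
  rw [walkEnd_replicate_true, PBond.tgt, emb_shift_eq_shiftN]

/-- **★ THE LOOP SUM DECOMPOSES**: `loopSum a c (r, σ, σ′) = stairSum(c₋, n_r, σ) + segSum(c₋, n_r, dir c) − stairSum(c₊, n_r, σ′) − axialSum(c)`.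
[cite: Balaban1987RG1, (0.4) p.253] -/
theorem loopSum_eq (a : PBond P j → ℝ) (c : PBond P (j + 1)) (i : Idx P) :
    loopSum a c i = stairSum a c.src (off i.1) i.2.1 + segSum a c.src (off i.1) c.dir - stairSum a c.tgt (off i.1) i.2.2 - axialSum a c := by
  obtain ⟨r, σ, σ'⟩ := i
  unfold loopSum loopWord
  rw [wsum_append, wsum_append, wsum_append]
  -- the four base points
  have h1 : walkEnd (emb c.src) (stairWord σ (off r)) = offPt c.src (off r) := walkEnd_stairWord_offPt c.src σ (off r)
  have h2 : walkEnd (offPt c.src (off r)) (List.replicate P.L (c.dir, true)) = walkEnd (emb c.tgt) (stairWord σ' (off r)) := by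
    rw [← h1, walkEnd_stairWord_replicate c.src c.dir σ σ' (off r), PBond.tgt]
  rw [h1, h2, wsum_wordRev, walkEnd_walkEnd_wordRev]
  have h4 : wsum a (emb c.tgt) (List.replicate P.L (c.dir, false)) = -axialSum a c := by
    rw [← wordRev_replicate_true, ← walkEnd_axial c, wsum_wordRev]; rfl
  rw [h4]
  simp only [stairSum, segSum]
  ring

/-! ## §3 The linear average: transported-segment mean plus a coboundary -/

/-- **THE SITE FUNCTION `Φ`**: the mean over the index set of the staircase sums from `emb y` (first ordering). [folklore] -/
def stairMean (a : PBond P j → ℝ) (y : Site P (j + 1)) : ℝ :=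
  (Fintype.card (Idx P) : ℝ)⁻¹ * ∑ i : Idx P, stairSum a y (off i.1) i.2.1

/-- **THE TRANSPORTED-SEGMENT MEAN** at a coarse bond. [cite: Balaban1987RG1, (0.4) p.253] -/
def segMean (a : PBond P j → ℝ) (c : PBond P (j + 1)) : ℝ :=
  (Fintype.card (Idx P) : ℝ)⁻¹ * ∑ i : Idx P, segSum a c.src (off i.1) c.dir

/-- The two staircase means coincide (swap the two orderings of the index). [folklore] -/
theorem sum_stairSum_snd_eq (a : PBond P j → ℝ) (y : Site P (j + 1)) :
    ∑ i : Idx P, stairSum a y (off i.1) i.2.2 = ∑ i : Idx P, stairSum a y (off i.1) i.2.1 := by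
  let e : Idx P ≃ Idx P := Equiv.prodCongr (Equiv.refl _) (Equiv.prodComm _ _)
  rw [← Equiv.sum_comp e (fun i : Idx P => stairSum a y (off i.1) i.2.1)]
  rfl

/-- **★ THE (0.4) LINEAR AVERAGE IS THE TRANSPORTED-SEGMENT MEAN PLUS A COBOUNDARY**: `linAvg04 a c = segMean a c + Φ(c₋) − Φ(c₊)`. [cite: Balaban1987RG1, (0.4) p.253] -/
theorem linAvg04_eq (a : PBond P j → ℝ) (c : PBond P (j + 1)) :
    linAvg04 a c = segMean a c + stairMean a c.src - stairMean a c.tgt := by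
  unfold linAvg04 segMean stairMean
  have hI : (0 : ℝ) < Fintype.card (Idx P) := Nat.cast_pos.mpr Fintype.card_pos
  simp_rw [loopSum_eq]
  rw [Finset.sum_sub_distrib, Finset.sum_sub_distrib, Finset.sum_add_distrib, sum_stairSum_snd_eq, Finset.sum_const, Finset.card_univ, nsmul_eq_mul]
  field_simp
  ring

/-! ## §4 The curl at a coarse plaquette: the coboundary drops, the segment mean gives the mean of the square fluxes -/

/-- **THE FLUX OF `a` AROUND THE `L`-SQUARE** based at the offset point `emb y + n` in the ordered directions `μ, ν` (the closed walk `L·e_μ, L·e_ν, −L·e_μ, −L·e_ν`).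
[cite: Balaban1985Averaging, (9) p.19] -/
def squareSum (a : PBond P j → ℝ) (y : Site P (j + 1)) (n : Fin P.d → ℤ) (μ ν : Fin P.d) : ℝ :=
  wsum a (offPt y n) (List.replicate P.L (μ, true) ++ (List.replicate P.L (ν, true) ++ (List.replicate P.L (μ, false) ++ List.replicate P.L (ν, false))))

/-- The offset point of the next block is the offset point shifted by `L`. [cite: Balaban1987RG1, (0.3) p.252] -/
theorem offPt_shift (y : Site P (j + 1)) (n : Fin P.d → ℤ) (μ : Fin P.d) :
    offPt (y.shift μ) n = walkEnd (offPt y n) (List.replicate P.L (μ, true)) := by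
  rw [offPt, offPt, walkEnd_stairWord_replicate y μ (Equiv.refl _) (Equiv.refl _) n]

/-- The square flux is the signed sum of the four transported segments. [folklore] -/
theorem squareSum_eq (a : PBond P j → ℝ) (y : Site P (j + 1)) (n : Fin P.d → ℤ) (μ ν : Fin P.d) :
    squareSum a y n μ ν = segSum a y n μ + segSum a (y.shift μ) n ν - segSum a (y.shift ν) n μ - segSum a y n ν := by
  unfold squareSum segSum
  rw [wsum_append, wsum_append, wsum_append, ← offPt_shift]
  have h2 : walkEnd (offPt (y.shift μ) n) (List.replicate P.L (ν, true)) = offPt ((y.shift μ).shift ν) n := (offPt_shift _ n ν).symm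
  rw [h2]
  -- third leg: backwards in `μ` from the far corner = minus the forward `μ`-segment from `offPt (y + e_ν) n`
  have hc : (y.shift μ).shift ν = (y.shift ν).shift μ := shift_shift_comm y μ ν
  have h3 : wsum a (offPt ((y.shift μ).shift ν) n) (List.replicate P.L (μ, false)) = -wsum a (offPt (y.shift ν) n) (List.replicate P.L (μ, true)) := by
    rw [hc, offPt_shift (y.shift ν) n μ, ← wordRev_replicate_true, wsum_wordRev]
  have h3e : walkEnd (offPt ((y.shift μ).shift ν) n) (List.replicate P.L (μ, false)) = offPt (y.shift ν) n := by
    rw [hc, offPt_shift (y.shift ν) n μ, ← wordRev_replicate_true, walkEnd_walkEnd_wordRev]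
  rw [h3e, h3]
  have h4 : wsum a (offPt (y.shift ν) n) (List.replicate P.L (ν, false)) = -wsum a (offPt y n) (List.replicate P.L (ν, true)) := by
    rw [offPt_shift y n ν, ← wordRev_replicate_true, wsum_wordRev]
  rw [h4]
  ring

/-- **★★ THE CURL OF THE (0.4) LINEAR AVERAGE AT A COARSE PLAQUETTE IS THE MEAN OF THE SQUARE FLUXES** (the coboundary `Φ(c₋) − Φ(c₊)` telescopes to zero around the plaquette).
[cite: Balaban1987RG1, (0.4) p.253; Balaban1985Averaging, (14) p.19] -/
theorem curl_linAvg04 (a : PBond P j → ℝ) (y : Site P (j + 1)) (μ ν : Fin P.d) :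
    linAvg04 a ⟨y, μ⟩ + linAvg04 a ⟨y.shift μ, ν⟩ - linAvg04 a ⟨y.shift ν, μ⟩ - linAvg04 a ⟨y, ν⟩ =
      (Fintype.card (Idx P) : ℝ)⁻¹ * ∑ i : Idx P, squareSum a y (off i.1) μ ν := by
  simp only [linAvg04_eq, segMean, PBond.tgt]
  rw [shift_shift_comm y μ ν]
  simp_rw [squareSum_eq]
  rw [Finset.sum_sub_distrib, Finset.sum_sub_distrib, Finset.sum_add_distrib]
  ring

end Summit.QuantumFields.YangMills.Theorems.AbelianEML

end
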